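import Mathlib
import Summits.Ventures.HodgeRepro.Tier4.Line1.ArchMatrixCoeff
import Summits.Ventures.HodgeRepro.Tier4.Line1.TotallyDefiniteCompact
import Summits.Ventures.HodgeRepro.Tier4.Line1.IsotypicIdempotent
import Summits.Ventures.HodgeRepro.Tier4.Line1.AdelicParts

/-!
# Tier4/Line1/InstanceType — (C-INST) THE INSTANCE BRIDGE OF ROW (6): `K := K_f(N) × G(k_∞) = finLevel W N`,
`ρ := σ ∘ pr_∞` for a K-type `σ` of the archimedean image, and `pr_∞(K_f(N) × G(k_∞)) = pr_∞(U(W)(𝔸_k))`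

Blind re-derivation cell `pub-hodge-repro`, Tier 4 (README §9–§10), seat t4-L1-p2 (gen 4), LINE L1; the cut
(C-INST) named by t4-plan-1 g3 (S14442; the planner's sketch Sketch-CInst.lean d73403cefcdf9b38 taken verbatim for
its nine declarations, the one content lemma `archImageLevel_eq` proved here).  Target tree path
`lean/Summits/Ventures/HodgeRepro/Tier4/Line1/InstanceType.lean`.  Imports this seat's `ArchMatrixCoeff` (`archMat`,
`archMat_apply`, `archEntry`, `finLevel`, `mem_finLevel`, `IsCongrFin`, `finCongrSet`), `TotallyDefiniteCompact`
(`isCompact_finLevel_of_totallyDefinite`) and `FinLevelCompact` through it (`zipMat`), t4-L1-p3's `IsotypicIdempotent`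
(`IsUnitaryRep`, `IsIrreducibleRep`) and t4-L1-p4's `AdelicParts` (`infM`, `finM`, `M4_ext`, `infM_mul`, `finM_mul`,
`infM_one`, `finM_one`, `finM_transpose`).  0 print.  (The transposition lemma for `infM` is private here: the tree
holds one under that name elsewhere.)

WHAT THIS IS.  The displayed `(K, ρ, hKo, hKc, hρ, hirr, hu)` of p5's `isolationRealised_isotypic` (IsotypicIdempotentData
p693283) become, on L1's instance, `(finLevel W N, instanceType W N σ, isOpen_finLevel W hN,
isCompact_finLevel_of_totallyDefinite W htot hN, continuous_instanceType …, isIrreducibleRep_instanceType …,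
isUnitaryRep_instanceType …)` — DISPLAYED after this module: `N ≠ 0`, `IsTotallyDefinite W` and the print's K-type
`σ : archImageLevel W N →* Matrix (Fin d) (Fin d) ℂ` (continuous, unitary, irreducible: Gross–Prasad's «a continuous
unitary irreducible representation of `U(W)(k_∞)`»), nothing else.  `archHom W : U(W)(𝔸_k) →* ∏_w M₄(ℂ)` is the
archimedean standard representation at all infinite places, `archImageLevel W N := pr_∞(K_f(N) × G(k_∞))` its image
on the level subgroup, `archProjLevel W N` the (surjective, continuous) projection and `instanceType W N σ := σ ∘ pr_∞`.

THE CONTENT LEMMA `archImageLevel_eq : archImageLevel W N = MonoidHom.mrange (archHom W)` («`pr_∞(K_f(N) × G(k_∞)) =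
pr_∞(U(W)(𝔸_k))`», no strong approximation): for `g ∈ U(W)(𝔸_k)` the element `(g_∞, 1_f)` — the adelic matrix
`zipMat k (infM k (GA.mat W g)) 1` — is a unit with inverse `zipMat k (infM k (GA.mat W g⁻¹)) 1` (`archUnit`), lies in
`U(W)(𝔸_k)` (the two unitary identities hold factor by factor in `𝔸_k = k_∞ × 𝔸_f`: the archimedean factor is `g`'s,
the finite factor is `1`'s — `M4_ext` with `infM` / `finM`; `archElt`), lies in `finLevel W N` for EVERY `N`
(`finM = 1`, so `finPart (A − 1) = 0 ∈ modSet`; `archElt_mem_finLevel`) and has the same archimedean image as `g`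
(`archEntry w` reads the `k_∞`-factor only; `archHom_archElt`, `rfl`).  It makes the domain of `σ` independent of `N`.
JUNK TESTS: `N = 0` — `modSet k 0 = {0}`, so `finLevel W 0 = {g | g_f = 1}` and the lemma still holds with the same
element; `d = 0` — `σ = 1` into `Matrix (Fin 0) (Fin 0) ℂ`, unitary and «irreducible» vacuously, harmless (the
consumer's `hirr` is never fed `d = 0` by the print).

Nothing here says anything about the status of the Hodge conjecture for CM abelian varieties, which is NOT proved
(HC_CM is NOT proved by anyone in this repository).
-/

set_option autoImplicit false

noncomputable section

namespace Summit.Ventures.HodgeRepro.Tier4.Line1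

open NumberField IsDedekindDomain Common Matrix

section Zip

variable (k : Type) [Field k] [NumberField k]

/-- the archimedean part of a zipped matrix. -/
theorem infM_zipMat (P : Matrix (Fin 4) (Fin 4) (InfiniteAdeleRing k))
    (Q : Matrix (Fin 4) (Fin 4) (FiniteAdeleRing (𝓞 k) k)) : infM k (zipMat k P Q) = P := by
  ext i j
  rfl

/-- the finite part of a zipped matrix. -/
theorem finM_zipMat (P : Matrix (Fin 4) (Fin 4) (InfiniteAdeleRing k))
    (Q : Matrix (Fin 4) (Fin 4) (FiniteAdeleRing (𝓞 k) k)) : finM k (zipMat k P Q) = Q := by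
  ext i j
  rfl

/-- `zipMat` is multiplicative (the product ring `𝔸_k = k_∞ × 𝔸_f`, entrywise). -/
theorem zipMat_mul (P P' : Matrix (Fin 4) (Fin 4) (InfiniteAdeleRing k))
    (Q Q' : Matrix (Fin 4) (Fin 4) (FiniteAdeleRing (𝓞 k) k)) :
    zipMat k P Q * zipMat k P' Q' = zipMat k (P * P') (Q * Q') :=
  M4_ext (by rw [infM_mul, infM_zipMat, infM_zipMat, infM_zipMat])
    (by rw [finM_mul, finM_zipMat, finM_zipMat, finM_zipMat])

/-- `zipMat 1 1 = 1`. -/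
theorem zipMat_one : zipMat k 1 1 = (1 : M4 k) :=
  M4_ext (by rw [infM_zipMat, infM_one]) (by rw [finM_zipMat, finM_one])

/-- the archimedean part commutes with transposition (private: the tree has this fact elsewhere). -/
private theorem infM_transpose_aux (M : M4 k) : infM k Mᵀ = (infM k M)ᵀ :=
  Matrix.transpose_map (f := infPart k) (M := M)

end Zip

section Sketch

variable {k : Type} [Field k] [NumberField k] (W : PlaneData k)

/-- the archimedean standard representation at ALL infinite places: `U(W)(𝔸_k) →* ∏_w M₄(ℂ)`. -/
def archHom : GA W →* (InfinitePlace k → Matrix (Fin 4) (Fin 4) ℂ) :=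
  MonoidHom.pi fun w => archMat W w

/-- the components of `archHom` (`rfl`). -/
theorem archHom_apply (g : GA W) (w : InfinitePlace k) : archHom W g w = archMat W w g := rfl

/-- `archHom` is continuous (entrywise, `continuous_archMat_entry`). -/
theorem continuous_archHom : Continuous (archHom W) := by
  refine continuous_pi fun w => continuous_pi fun i => continuous_pi fun j => ?_
  exact continuous_archMat_entry W w i j

/-- the archimedean image of `K_f(N) × G(k_∞)`: a submonoid of `∏_w M₄(ℂ)` («`U(W)(k_∞)`»). -/
def archImageLevel (N : ℕ) : Submonoid (InfinitePlace k → Matrix (Fin 4) (Fin 4) ℂ) :=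
  MonoidHom.mrange ((archHom W).comp (finLevel W N).subtype)

/-- the archimedean projection `pr_∞ : K_f(N) × G(k_∞) →* pr_∞(K_f(N) × G(k_∞))`. -/
def archProjLevel (N : ℕ) : finLevel W N →* archImageLevel W N :=
  ((archHom W).comp (finLevel W N).subtype).mrangeRestrict

/-- the archimedean projection is surjective. -/
theorem archProjLevel_surjective (N : ℕ) : Function.Surjective (archProjLevel W N) :=
  MonoidHom.mrangeRestrict_surjective _

/-- the archimedean projection is continuous. -/
theorem continuous_archProjLevel (N : ℕ) : Continuous (archProjLevel W N) :=
  ((continuous_archHom W).comp continuous_subtype_val).subtype_mk _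

/-- **the instance's type** `ρ := σ ∘ pr_∞` on `K := K_f(N) × G(k_∞)`. -/
def instanceType (N : ℕ) {d : ℕ} (σ : archImageLevel W N →* Matrix (Fin d) (Fin d) ℂ) :
    finLevel W N →* Matrix (Fin d) (Fin d) ℂ :=
  σ.comp (archProjLevel W N)

/-- the instance's type is continuous when `σ` is. -/
theorem continuous_instanceType (N : ℕ) {d : ℕ} (σ : archImageLevel W N →* Matrix (Fin d) (Fin d) ℂ)
    (hσ : Continuous σ) : Continuous (instanceType W N σ) :=
  hσ.comp (continuous_archProjLevel W N)

/-- the instance's type is unitary when `σ` is. -/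
theorem isUnitaryRep_instanceType (N : ℕ) {d : ℕ} (σ : archImageLevel W N →* Matrix (Fin d) (Fin d) ℂ)
    (hσ : ∀ u, (σ u)ᴴ * σ u = 1) : RTF.Setting.IsUnitaryRep (instanceType W N σ) :=
  ⟨fun _ => hσ _⟩

/-- the instance's type is irreducible when `σ` is (pull-back along the surjection `pr_∞`). -/
theorem isIrreducibleRep_instanceType (N : ℕ) {d : ℕ} (σ : archImageLevel W N →* Matrix (Fin d) (Fin d) ℂ)
    (hσ : ∀ U : Submodule ℂ (Fin d → ℂ), (∀ u, ∀ v ∈ U, (σ u).mulVec v ∈ U) → U = ⊥ ∨ U = ⊤) :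
    RTF.Setting.IsIrreducibleRep (instanceType W N σ) := by
  refine ⟨fun U hU => hσ U fun u v hv => ?_⟩
  obtain ⟨x, rfl⟩ := archProjLevel_surjective W N u
  exact hU x v hv

/-- the open/compact facts of `K := finLevel W N` by name (totally definite plane, `N ≠ 0`). -/
theorem isOpen_isCompact_finLevel (htot : IsTotallyDefinite W) {N : ℕ} (hN : N ≠ 0) :
    IsOpen (finLevel W N : Set (GA W)) ∧ IsCompact (finLevel W N : Set (GA W)) :=
  ⟨isOpen_finLevel W hN, isCompact_finLevel_of_totallyDefinite W htot hN⟩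

end Sketch

section Content

variable {k : Type} [Field k] [NumberField k] (W : PlaneData k)

/-- **the element `(g_∞, 1_f)`** as a unit of `M₄(𝔸_k)`: the archimedean factor of `g`, the finite factor `1`. -/
def archUnit (g : GA W) : GL4 k where
  val := zipMat k (infM k (GA.mat W g)) 1
  inv := zipMat k (infM k (GA.mat W g⁻¹)) 1
  val_inv := by rw [zipMat_mul, ← infM_mul, GA.mat_mul_inv, infM_one, mul_one, zipMat_one]
  inv_val := by rw [zipMat_mul, ← infM_mul, GA.mat_inv_mul, infM_one, mul_one, zipMat_one]

/-- the matrix of `archUnit` (`rfl`). -/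
theorem archUnit_val (g : GA W) : ((archUnit W g : GL4 k) : M4 k) = zipMat k (infM k (GA.mat W g)) 1 := rfl

/-- the matrix of the inverse of `archUnit` (`rfl`). -/
theorem archUnit_inv_val (g : GA W) :
    (((archUnit W g)⁻¹ : GL4 k) : M4 k) = zipMat k (infM k (GA.mat W g⁻¹)) 1 := rfl

/-- **`(g_∞, 1_f)` lies in `U(W)(𝔸_k)`**: the two unitary identities hold factor by factor (the archimedean factor is
`g`'s, the finite factor is `1`'s). -/
theorem archUnit_mem (g : GA W) : archUnit W g ∈ unitaryGroup W := by
  obtain ⟨h1, h2⟩ := (mem_unitaryGroup W (g : GL4 k)).1 g.2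
  refine ⟨?_, ?_⟩
  · apply M4_ext
    · rw [infM_mul, infM_mul, archUnit_val, infM_zipMat, ← infM_mul, ← infM_mul]
      exact congrArg (infM k) h1
    · rw [finM_mul, finM_mul, archUnit_val, finM_zipMat, one_mul, mul_one]
  · apply M4_ext
    · rw [infM_mul, infM_mul, infM_transpose_aux, archUnit_val, infM_zipMat, ← infM_transpose_aux, ← infM_mul,
        ← infM_mul]
      exact congrArg (infM k) h2
    · rw [finM_mul, finM_mul, finM_transpose, archUnit_val, finM_zipMat, Matrix.transpose_one, one_mul, mul_one]

/-- **the element `(g_∞, 1_f)` of `U(W)(𝔸_k)`**. -/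
def archElt (g : GA W) : GA W := ⟨archUnit W g, archUnit_mem W g⟩

/-- the matrix of `archElt` (`rfl`). -/
theorem mat_archElt (g : GA W) : GA.mat W (archElt W g) = zipMat k (infM k (GA.mat W g)) 1 := rfl

/-- the matrix of the inverse of `archElt` (`rfl`). -/
theorem mat_archElt_inv (g : GA W) : GA.mat W (archElt W g)⁻¹ = zipMat k (infM k (GA.mat W g⁻¹)) 1 := rfl

/-- a matrix with finite part `1` is `≡ 1 (mod N)` in the finite components, for every `N`. -/
theorem isCongrFin_of_finM_eq_one (N : ℕ) {A : M4 k} (hA : finM k A = 1) : IsCongrFin k N A := by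
  intro i j
  rw [mem_finCongrSet, Matrix.sub_apply, map_sub]
  have e1 : finPart k (A i j) = finPart k ((1 : M4 k) i j) :=
    (congrFun (congrFun hA i) j).trans (congrFun (congrFun (finM_one (k := k)) i) j).symm
  rw [e1, sub_self]
  exact zero_mem_modSet k N

/-- **`(g_∞, 1_f)` lies in `K_f(N) × G(k_∞)` for every level `N`** (its finite part is `1`). -/
theorem archElt_mem_finLevel (g : GA W) (N : ℕ) : archElt W g ∈ finLevel W N := by
  rw [mem_finLevel]
  refine ⟨?_, ?_⟩
  · exact isCongrFin_of_finM_eq_one N (by rw [mat_archElt, finM_zipMat])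
  · exact isCongrFin_of_finM_eq_one N (by rw [mat_archElt_inv, finM_zipMat])

/-- **`(g_∞, 1_f)` has the archimedean image of `g`** (`archEntry w` reads the `k_∞`-factor only; `rfl`). -/
theorem archHom_archElt (g : GA W) : archHom W (archElt W g) = archHom W g := rfl

/-- **(C-INST-SURJ)** `pr_∞(K_f(N) × G(k_∞)) = pr_∞(U(W)(𝔸_k))`: the element `(g_∞, 1_f)` lies in `finLevel W N` with
the archimedean image of `g`. -/
theorem archImageLevel_eq (N : ℕ) : archImageLevel W N = MonoidHom.mrange (archHom W) := by
  refine le_antisymm ?_ ?_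
  · rintro _ ⟨⟨g, _⟩, rfl⟩
    exact ⟨g, rfl⟩
  · rintro _ ⟨g, rfl⟩
    exact ⟨⟨archElt W g, archElt_mem_finLevel W g N⟩, archHom_archElt W g⟩

/-- the archimedean image of the level subgroup is independent of the level. -/
theorem archImageLevel_eq_archImageLevel (N N' : ℕ) : archImageLevel W N = archImageLevel W N' := by
  rw [archImageLevel_eq, archImageLevel_eq]

end Content

end Summit.Ventures.HodgeRepro.Tier4.Line1

end
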